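import Mathlib
import HarnessLib
import Summits.HubbardSuperconductivity.HubbardSuperconductivity.Theorems.KLProgrammeKLRegimeEnginePlaneWaveConservation

/-!
# Route `KLProgramme` — ENGINE item stmt-HubbardSuperconductivity-20437, class #6 / (E5-F)ₙ producer, route (M) of the (α-0) memo:
# THE MOMENTUM KERNELS OF A CONSERVING POLYNOMIAL ARE LIPSCHITZ ALONG THE CONSERVATION SURFACE, with constant the pinned FIRST MOMENT of
# the sectorised position kernel (§2.2 of the memo, brick M4 (ii)); pinned sizes and moments do not depend on the pin (M4 (iii));
# instances on `𝒱ₙ[K]`, `klIsoKernelAt`, `klAnisoLegKernel`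

Cell gate-hubbard-kl, seat hubbard-kl-k3c2-p2 (g11; owner-designate of M1 + M3 of route (M), pen (R59az)).  Route (M) bounds the near part of the class-#6 size
`fixedTupleL1 β 3 (klIsoKernelAt … K_n n m) Ω x₁` by the sup of the momentum kernel of `𝒱ₙ[K]` on the support box of the iso tuple `Ω`
(`fixedTupleL1_le_nearFar_cons` / `fixedTupleL1_sectorisedKernel_le_near_add_far`), and the (E5-F)ₙ hypothesis delivers that kernel only at ONE point per box (frequency
`ω₀`, momenta in `klBall`).  The missing step (ALPHA0-SCOPING-MEMO §2.2) is a Lipschitz bound of the momentum kernel ALONG THE CONSERVATION SURFACE whose constant is an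
IRRELEVANT datum, the pinned first moment of the position kernel — the quantity the tower exports per tuple ((E4)/(E4-iso)ₙ).  By the Fourier inversion
`sum_sectorisedKernel_mul_conj_prod` (`|Λ|^m·(∏_i F_{ω_i}(k_i))·K(k) = Σ_x W_Ω(x)·conj(∏_i e^{-is_i k_i·x_i})`) it reduces to the phase-string estimate of
`…EnginePlaneWaveConservation` (`norm_conj_prod_hubbardPlaneWave_sub_le`); translation invariance (`norm_sectorisedKernel_translate`, `sum_eq_card_mul_sum_pinned`) then
turns the all-legs sum into a pinned one.  This file:

* §1 **pin independence** (conserving `G`): `fixedTupleL1 β m (sectorisedKernel β F G (m+1)) Ω x₁` and the pinned first moments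
  `Σ_y spaceTimeDist ((x₁::y) i) ((x₁::y) j)·‖W_Ω(x₁::y)‖` do not depend on `x₁` (`fixedTupleL1_sectorisedKernel_pin_indep`, `firstMoment_sectorisedKernel_pin_indep`);
* §2 **the Lipschitz bound, all legs summed** (ANY `G`; `k`, `k′` on the conservation surface of the charges of `Ω`; any reference leg `i₀`):
  `|Λ|^m·‖(∏F·K)(k) − (∏F·K)(k′)‖ ≤ Σ_x (Σ_i δ_i·spaceTimeDist (x_i) (x_{i₀}))·‖W_Ω(x)‖`, `δ_i = |ω_{k_i} − ω_{k′_i}| + 2|k⃗_i − k⃗′_i|_𝕋`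
  (`card_pow_mul_norm_prodKernel_sub_le`);
* §3 **pinned forms for a conserving `G`** (`m+1` legs, leg `0` pinned at any `x₁`): `|Λ|^m·‖…‖ ≤ Σ_y (Σ_j δ_{j+1}·spaceTimeDist (y_j) x₁)·‖W_Ω(x₁::y)‖`
  (`card_pow_mul_norm_prodKernel_sub_le_pinned`); in the route's currency `(βL²)^m·‖…‖ ≤ δ·Σ_j ε^m Σ_y spaceTimeDist x₁ (y_j)·‖W_Ω(x₁::y)‖` for any common bound `δ` of the
  free legs' dual distances (`pow_mul_norm_prodKernel_sub_le_moments`) and for the vertex functions `𝒱_{m+1} = (m+1)!(βL²)^m·K`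
  (`norm_prod_mul_vertexFn_sub_le_moments`) — the leg-`0` momenta are slaved by conservation and cost nothing;
* §4 **instances on `𝒱ₙ[K] = klEffectiveAction … n`** (conservation from `kernel_klEffectiveAction_eq_zero_of_freq`, `klEffectiveAction_momentumConserving`): pin
  independence of the class-#6 size `fixedTupleL1 β 3 (klIsoKernelAt … n m) Ω x₁` (`fixedTupleL1_klIsoKernelAt_pin_indep`) and of the (E4) moments of `klAnisoLegKernel … n 4`
  (`firstMoment_klAnisoLegKernel_pin_indep`), and the moment-Lipschitz bound of `𝒱ₙ[K]`'s quartic momentum kernel / vertex function under any multiplier family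
  (`pow_mul_norm_prodKernel_klEffectiveAction_sub_le_moments`, `norm_prod_mul_vertexFn_klEffectiveAction_sub_le_moments`).

What M3 adds on top (not here): the box geometry of `klIsoFamily` (the `δ` of two momenta in one iso box, `≍ Λ_m`), the fattened-family plateau `∏F ≡ 1` on the box, and the
(E4-iso)ₙ moment datum.  Everything is proved; no definitions; nothing about the model is asserted beyond these implications.
References: BGM 2006 §2.3 (2.17), §2.4 (2.52), §2.7 (2.70)–(2.71a) [cite: BenfattoGiulianiMastropietro2006]; Salmhofer 1999 §4.2.4, App. B.5.5 [cite: Salmhofer1999].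
-/

noncomputable section

namespace Summit.HubbardSuperconductivity.HubbardSuperconductivity.Theorems.EngineV8

set_option linter.dupNamespace false -- summit = problem name (single-conjunct summit), D-0017

open Classical
open Real Finset Complex Literature.MathematicalPhysics.QuantumLattice Literature.Probability.LatticeModels GrassmannAlgebra
open Summit.HubbardSuperconductivity.HubbardSuperconductivity.Theorems.KLProgrammeLegKernels
open Summit.HubbardSuperconductivity.HubbardSuperconductivity.Theorems.KLRegimeSplit
open scoped ComplexConjugate

open Summit.HubbardSuperconductivity.HubbardSuperconductivity.Theorems.KLRegimeWick

variable {L M : ℕ} [NeZero L] [NeZero M]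

/-! ## §1 Pinned sizes and moments of a conserving polynomial do not depend on the pin -/

section Pin

/-- **`fixedTupleL1` does not depend on the pin** for a frequency- and momentum-conserving polynomial. -/
theorem fixedTupleL1_sectorisedKernel_pin_indep {N m : ℕ} {β : ℝ} (hβ : β ≠ 0) (F : Fin N → FreqMomentum L M → ℂ) (G : HubbardGrassmann L M)
    (hfreq : ∀ (m : ℕ) (X : Fin m → HubbardFieldIdx L M),
      (∑ i, (if (X i).2 = 0 then (1 : ℤ) else -1) * matsubaraInt M (X i).1.1.1) ≠ 0 → kernel ℂ G m X = 0)
    (hmom : ∀ (m : ℕ) (X : Fin m → HubbardFieldIdx L M), (∑ i, signedMomentum L (X i).2 (X i).1.1.2) ≠ 0 → kernel ℂ G m X = 0)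
    (Ω : Fin (m + 1) → SectorLeg N) (x₁ x₁' : SpaceTimeIdx L M) :
    fixedTupleL1 L M β m (sectorisedKernel L M β F G (m + 1)) Ω x₁ = fixedTupleL1 L M β m (sectorisedKernel L M β F G (m + 1)) Ω x₁' := by
  have hcard : (0 : ℝ) < Fintype.card (SpaceTimeIdx L M) := by exact_mod_cast Fintype.card_pos
  have key := fun x₀ : SpaceTimeIdx L M => sum_eq_card_mul_sum_pinned (fun x => ‖sectorisedKernel L M β F G (m + 1) Ω x‖)
    (fun x a => norm_sectorisedKernel_translate hβ F G hfreq hmom (m + 1) Ω x a) x₀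
  unfold fixedTupleL1
  rw [mul_left_cancel₀ hcard.ne' ((key x₁).symm.trans (key x₁'))]

/-- **The pinned first moments do not depend on the pin** for a conserving polynomial (legs `i`, `j` of the pinned tuple; weight `spaceTimeDist`). -/
theorem firstMoment_sectorisedKernel_pin_indep {N m : ℕ} {β : ℝ} (hβ : β ≠ 0) (F : Fin N → FreqMomentum L M → ℂ) (G : HubbardGrassmann L M)
    (hfreq : ∀ (m : ℕ) (X : Fin m → HubbardFieldIdx L M),
      (∑ i, (if (X i).2 = 0 then (1 : ℤ) else -1) * matsubaraInt M (X i).1.1.1) ≠ 0 → kernel ℂ G m X = 0)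
    (hmom : ∀ (m : ℕ) (X : Fin m → HubbardFieldIdx L M), (∑ i, signedMomentum L (X i).2 (X i).1.1.2) ≠ 0 → kernel ℂ G m X = 0)
    (Ω : Fin (m + 1) → SectorLeg N) (i j : Fin (m + 1)) (x₁ x₁' : SpaceTimeIdx L M) :
    ∑ y : Fin m → SpaceTimeIdx L M, spaceTimeDist L M β (Matrix.vecCons x₁ y i) (Matrix.vecCons x₁ y j) * ‖sectorisedKernel L M β F G (m + 1) Ω (Matrix.vecCons x₁ y)‖ =
      ∑ y : Fin m → SpaceTimeIdx L M, spaceTimeDist L M β (Matrix.vecCons x₁' y i) (Matrix.vecCons x₁' y j) * ‖sectorisedKernel L M β F G (m + 1) Ω (Matrix.vecCons x₁' y)‖ := by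
  have hcard : (0 : ℝ) < Fintype.card (SpaceTimeIdx L M) := by exact_mod_cast Fintype.card_pos
  have hinv : ∀ (x : Fin (m + 1) → SpaceTimeIdx L M) (a : SpaceTimeIdx L M),
      spaceTimeDist L M β (((x i).1 + a.1, (x i).2 + a.2) : SpaceTimeIdx L M) ((x j).1 + a.1, (x j).2 + a.2) *
          ‖sectorisedKernel L M β F G (m + 1) Ω (fun l => ((x l).1 + a.1, (x l).2 + a.2))‖ =
        spaceTimeDist L M β (x i) (x j) * ‖sectorisedKernel L M β F G (m + 1) Ω x‖ := fun x a => by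
    rw [spaceTimeDist_translate, norm_sectorisedKernel_translate hβ F G hfreq hmom (m + 1) Ω x a]
  have key := fun x₀ : SpaceTimeIdx L M => sum_eq_card_mul_sum_pinned
    (fun x => spaceTimeDist L M β (x i) (x j) * ‖sectorisedKernel L M β F G (m + 1) Ω x‖) hinv x₀
  exact mul_left_cancel₀ hcard.ne' ((key x₁).symm.trans (key x₁'))

end Pin

/-! ## §2 The Lipschitz bound of the momentum kernels along the conservation surface, all legs summed -/

section Lipschitz

omit [NeZero M] in
/-- **MOMENTUM-LIPSCHITZ FROM THE FIRST MOMENT** (any polynomial `G`, `0 < β`): for two momentum strings `k`, `k′` on the conservation surface of the charges of `Ω`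
(signed frequencies and signed momenta summing to zero) and any reference leg `i₀`,
`|Λ|^m·‖(∏_i F_{ω_i}(k_i))·K(k) − (∏_i F_{ω_i}(k′_i))·K(k′)‖ ≤ Σ_x (Σ_i δ_i·spaceTimeDist (x_i) (x_{i₀}))·‖W_Ω(x)‖` with `δ_i = |ω_{k_i} − ω_{k′_i}| + 2|k⃗_i − k⃗′_i|_𝕋`
(`K = kernel ℂ G m`, `W = sectorisedKernel β F G m`): Fourier inversion of both strings, then the phase-string estimate leg by leg relative to `x_{i₀}`. -/
theorem card_pow_mul_norm_prodKernel_sub_le {N m : ℕ} {β : ℝ} (hβ : 0 < β) (F : Fin N → FreqMomentum L M → ℂ) (G : HubbardGrassmann L M)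
    (Ω : Fin m → SectorLeg N) (k k' : Fin m → FreqMomentum L M)
    (hf : ∑ i, (if (Ω i).2 = 0 then (1 : ℤ) else -1) * matsubaraInt M (k i).1 = 0) (hm : ∑ i, signedMomentum L (Ω i).2 (k i).2 = 0)
    (hf' : ∑ i, (if (Ω i).2 = 0 then (1 : ℤ) else -1) * matsubaraInt M (k' i).1 = 0) (hm' : ∑ i, signedMomentum L (Ω i).2 (k' i).2 = 0)
    (i₀ : Fin m) :
    (Fintype.card (SpaceTimeIdx L M) : ℝ) ^ m *
        ‖(∏ i, F (Ω i).1.1 (k i)) * kernel ℂ G m (fun i => ((k i, (Ω i).1.2), (Ω i).2)) -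
          (∏ i, F (Ω i).1.1 (k' i)) * kernel ℂ G m (fun i => ((k' i, (Ω i).1.2), (Ω i).2))‖ ≤
      ∑ x : Fin m → SpaceTimeIdx L M,
        (∑ i, (|matsubaraFreq β M (k i).1 - matsubaraFreq β M (k' i).1| + 2 * klTorusNorm L ((k i).2 - (k' i).2)) * spaceTimeDist L M β (x i) (x i₀)) *
          ‖sectorisedKernel L M β F G m Ω x‖ := by
  haveI : NeZero M := by
    rcases Nat.eq_zero_or_pos m with hm0 | hmpos
    · subst hm0; exact absurd i₀.isLt (by omega)
    · exact ⟨(Nat.pos_of_mul_pos_left (k ⟨0, hmpos⟩).1.pos).ne'⟩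
  have hk := sum_sectorisedKernel_mul_conj_prod hβ.ne' F G m Ω k
  have hk' := sum_sectorisedKernel_mul_conj_prod hβ.ne' F G m Ω k'
  have hdiff : ((Fintype.card (SpaceTimeIdx L M) : ℂ)) ^ m *
      ((∏ i, F (Ω i).1.1 (k i)) * kernel ℂ G m (fun i => ((k i, (Ω i).1.2), (Ω i).2)) -
        (∏ i, F (Ω i).1.1 (k' i)) * kernel ℂ G m (fun i => ((k' i, (Ω i).1.2), (Ω i).2))) =
      ∑ x : Fin m → SpaceTimeIdx L M, sectorisedKernel L M β F G m Ω x *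
        (conj (∏ i, hubbardPlaneWave L M β (Ω i).2 (k i) (x i)) - conj (∏ i, hubbardPlaneWave L M β (Ω i).2 (k' i) (x i))) := by
    rw [mul_sub, ← mul_assoc, ← mul_assoc, ← hk, ← hk', ← sum_sub_distrib]
    exact sum_congr rfl fun x _ => by ring
  have hnorm : (Fintype.card (SpaceTimeIdx L M) : ℝ) ^ m *
      ‖(∏ i, F (Ω i).1.1 (k i)) * kernel ℂ G m (fun i => ((k i, (Ω i).1.2), (Ω i).2)) -
        (∏ i, F (Ω i).1.1 (k' i)) * kernel ℂ G m (fun i => ((k' i, (Ω i).1.2), (Ω i).2))‖ =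
      ‖((Fintype.card (SpaceTimeIdx L M) : ℂ)) ^ m *
        ((∏ i, F (Ω i).1.1 (k i)) * kernel ℂ G m (fun i => ((k i, (Ω i).1.2), (Ω i).2)) -
          (∏ i, F (Ω i).1.1 (k' i)) * kernel ℂ G m (fun i => ((k' i, (Ω i).1.2), (Ω i).2)))‖ := by
    rw [norm_mul, norm_pow, Complex.norm_natCast]
  rw [hnorm, hdiff]
  refine (norm_sum_le _ _).trans (sum_le_sum fun x _ => ?_)
  rw [norm_mul, mul_comm]
  exact mul_le_mul_of_nonneg_right
    (norm_conj_prod_hubbardPlaneWave_sub_le hβ (fun i => (Ω i).2) k k' hf hm hf' hm' x (x i₀)) (norm_nonneg _)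

end Lipschitz

/-! ## §3 Pinned forms for a conserving polynomial -/

section Pinned

/-- **The Lipschitz bound, pinned** (conserving `G`, `m+1` legs, leg `0` pinned at ANY `x₁`):
`|Λ|^m·‖(∏F·K)(k) − (∏F·K)(k′)‖ ≤ Σ_y (Σ_j δ_{j+1}·spaceTimeDist (y_j) x₁)·‖W_Ω(x₁ :: y)‖` — the all-legs sum of §2 (reference leg `0`) is `|Λ|` times the pinned one by
translation invariance, and leg `0` contributes no distance. -/
theorem card_pow_mul_norm_prodKernel_sub_le_pinned {N m : ℕ} {β : ℝ} (hβ : 0 < β) (F : Fin N → FreqMomentum L M → ℂ) (G : HubbardGrassmann L M)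
    (hfreq : ∀ (m : ℕ) (X : Fin m → HubbardFieldIdx L M),
      (∑ i, (if (X i).2 = 0 then (1 : ℤ) else -1) * matsubaraInt M (X i).1.1.1) ≠ 0 → kernel ℂ G m X = 0)
    (hmom : ∀ (m : ℕ) (X : Fin m → HubbardFieldIdx L M), (∑ i, signedMomentum L (X i).2 (X i).1.1.2) ≠ 0 → kernel ℂ G m X = 0)
    (Ω : Fin (m + 1) → SectorLeg N) (k k' : Fin (m + 1) → FreqMomentum L M)
    (hf : ∑ i, (if (Ω i).2 = 0 then (1 : ℤ) else -1) * matsubaraInt M (k i).1 = 0) (hm : ∑ i, signedMomentum L (Ω i).2 (k i).2 = 0)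
    (hf' : ∑ i, (if (Ω i).2 = 0 then (1 : ℤ) else -1) * matsubaraInt M (k' i).1 = 0) (hm' : ∑ i, signedMomentum L (Ω i).2 (k' i).2 = 0)
    (x₁ : SpaceTimeIdx L M) :
    (Fintype.card (SpaceTimeIdx L M) : ℝ) ^ m *
        ‖(∏ i, F (Ω i).1.1 (k i)) * kernel ℂ G (m + 1) (fun i => ((k i, (Ω i).1.2), (Ω i).2)) -
          (∏ i, F (Ω i).1.1 (k' i)) * kernel ℂ G (m + 1) (fun i => ((k' i, (Ω i).1.2), (Ω i).2))‖ ≤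
      ∑ y : Fin m → SpaceTimeIdx L M,
        (∑ j : Fin m, (|matsubaraFreq β M (k j.succ).1 - matsubaraFreq β M (k' j.succ).1| + 2 * klTorusNorm L ((k j.succ).2 - (k' j.succ).2)) *
            spaceTimeDist L M β (y j) x₁) *
          ‖sectorisedKernel L M β F G (m + 1) Ω (Matrix.vecCons x₁ y)‖ := by
  have hcard : (0 : ℝ) < Fintype.card (SpaceTimeIdx L M) := by exact_mod_cast Fintype.card_pos
  set δ : Fin (m + 1) → ℝ := fun i => |matsubaraFreq β M (k i).1 - matsubaraFreq β M (k' i).1| + 2 * klTorusNorm L ((k i).2 - (k' i).2) with hδ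
  -- the all-legs bound with reference leg `0`
  have hall := card_pow_mul_norm_prodKernel_sub_le hβ F G Ω k k' hf hm hf' hm' 0
  -- the all-legs sum is `|Λ|` times the pinned sum
  have hinv : ∀ (x : Fin (m + 1) → SpaceTimeIdx L M) (a : SpaceTimeIdx L M),
      (∑ i, δ i * spaceTimeDist L M β (((x i).1 + a.1, (x i).2 + a.2) : SpaceTimeIdx L M) ((x 0).1 + a.1, (x 0).2 + a.2)) *
          ‖sectorisedKernel L M β F G (m + 1) Ω (fun l => ((x l).1 + a.1, (x l).2 + a.2))‖ =
        (∑ i, δ i * spaceTimeDist L M β (x i) (x 0)) * ‖sectorisedKernel L M β F G (m + 1) Ω x‖ := fun x a => by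
    simp_rw [spaceTimeDist_translate]
    rw [norm_sectorisedKernel_translate hβ.ne' F G hfreq hmom (m + 1) Ω x a]
  have hpin := sum_eq_card_mul_sum_pinned
    (fun x => (∑ i, δ i * spaceTimeDist L M β (x i) (x 0)) * ‖sectorisedKernel L M β F G (m + 1) Ω x‖) hinv x₁
  -- leg `0` of `x₁ :: y` sits at `x₁`: no distance
  have hcons : ∀ y : Fin m → SpaceTimeIdx L M,
      (∑ i, δ i * spaceTimeDist L M β (Matrix.vecCons x₁ y i) (Matrix.vecCons x₁ y 0)) =
        ∑ j : Fin m, δ j.succ * spaceTimeDist L M β (y j) x₁ := by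
    intro y
    rw [Fin.sum_univ_succ]
    simp only [Matrix.cons_val_zero, Matrix.cons_val_succ, spaceTimeDist_self, mul_zero, zero_add]
  simp_rw [hcons] at hpin
  -- divide the all-legs bound by `|Λ|`
  rw [pow_succ, mul_comm _ (Fintype.card (SpaceTimeIdx L M) : ℝ), mul_assoc] at hall
  rw [hpin] at hall
  exact le_of_mul_le_mul_left hall hcard

/-- **The Lipschitz bound in the route's currency** (`(βL²)^m = (ε|Λ|)^m`): for any common bound `δ` of the FREE legs' dual distances,
`(βL²)^m·‖(∏F·K)(k) − (∏F·K)(k′)‖ ≤ δ·Σ_j ε^m Σ_y spaceTimeDist x₁ (y_j)·‖W_Ω(x₁ :: y)‖` — `δ` times the sum of the `m` pinned first moments ((E4) currency). -/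
theorem pow_mul_norm_prodKernel_sub_le_moments {N m : ℕ} {β : ℝ} (hβ : 0 < β) (F : Fin N → FreqMomentum L M → ℂ) (G : HubbardGrassmann L M)
    (hfreq : ∀ (m : ℕ) (X : Fin m → HubbardFieldIdx L M),
      (∑ i, (if (X i).2 = 0 then (1 : ℤ) else -1) * matsubaraInt M (X i).1.1.1) ≠ 0 → kernel ℂ G m X = 0)
    (hmom : ∀ (m : ℕ) (X : Fin m → HubbardFieldIdx L M), (∑ i, signedMomentum L (X i).2 (X i).1.1.2) ≠ 0 → kernel ℂ G m X = 0)
    (Ω : Fin (m + 1) → SectorLeg N) (k k' : Fin (m + 1) → FreqMomentum L M)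
    (hf : ∑ i, (if (Ω i).2 = 0 then (1 : ℤ) else -1) * matsubaraInt M (k i).1 = 0) (hm : ∑ i, signedMomentum L (Ω i).2 (k i).2 = 0)
    (hf' : ∑ i, (if (Ω i).2 = 0 then (1 : ℤ) else -1) * matsubaraInt M (k' i).1 = 0) (hm' : ∑ i, signedMomentum L (Ω i).2 (k' i).2 = 0)
    (x₁ : SpaceTimeIdx L M) {δ : ℝ}
    (hδ : ∀ j : Fin m, |matsubaraFreq β M (k j.succ).1 - matsubaraFreq β M (k' j.succ).1| + 2 * klTorusNorm L ((k j.succ).2 - (k' j.succ).2) ≤ δ) :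
    (β * (L : ℝ) ^ 2) ^ m *
        ‖(∏ i, F (Ω i).1.1 (k i)) * kernel ℂ G (m + 1) (fun i => ((k i, (Ω i).1.2), (Ω i).2)) -
          (∏ i, F (Ω i).1.1 (k' i)) * kernel ℂ G (m + 1) (fun i => ((k' i, (Ω i).1.2), (Ω i).2))‖ ≤
      δ * ∑ j : Fin m, imagTimeWeight β M ^ m *
        ∑ y : Fin m → SpaceTimeIdx L M, spaceTimeDist L M β x₁ (y j) * ‖sectorisedKernel L M β F G (m + 1) Ω (Matrix.vecCons x₁ y)‖ := by
  have hε : 0 ≤ imagTimeWeight β M := imagTimeWeight_nonneg hβ.le M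
  have hεm : 0 ≤ imagTimeWeight β M ^ m := pow_nonneg hε m
  have hd0 : ∀ (y : Fin m → SpaceTimeIdx L M) (j : Fin m), 0 ≤ spaceTimeDist L M β (y j) x₁ := fun y j => by
    unfold KLRegimeSplit.spaceTimeDist; exact le_max_of_le_right (le_max_of_le_left (Nat.cast_nonneg _))
  have hpin := card_pow_mul_norm_prodKernel_sub_le_pinned hβ F G hfreq hmom Ω k k' hf hm hf' hm' x₁
  -- `(βL²)^m = ε^m |Λ|^m`
  rw [← imagTimeWeight_mul_card β L M, mul_pow, mul_assoc]
  refine (mul_le_mul_of_nonneg_left hpin hεm).trans ?_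
  -- bound each leg's coefficient by `δ` and reorder the sums
  calc imagTimeWeight β M ^ m * ∑ y : Fin m → SpaceTimeIdx L M,
        (∑ j : Fin m, (|matsubaraFreq β M (k j.succ).1 - matsubaraFreq β M (k' j.succ).1| + 2 * klTorusNorm L ((k j.succ).2 - (k' j.succ).2)) *
            spaceTimeDist L M β (y j) x₁) * ‖sectorisedKernel L M β F G (m + 1) Ω (Matrix.vecCons x₁ y)‖
      ≤ imagTimeWeight β M ^ m * ∑ y : Fin m → SpaceTimeIdx L M,
          (∑ j : Fin m, δ * spaceTimeDist L M β (y j) x₁) * ‖sectorisedKernel L M β F G (m + 1) Ω (Matrix.vecCons x₁ y)‖ := by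
        refine mul_le_mul_of_nonneg_left (sum_le_sum fun y _ => mul_le_mul_of_nonneg_right (sum_le_sum fun j _ =>
          mul_le_mul_of_nonneg_right (hδ j) (hd0 y j)) (norm_nonneg _)) hεm
    _ = ∑ y : Fin m → SpaceTimeIdx L M, ∑ j : Fin m, δ * (imagTimeWeight β M ^ m *
          (spaceTimeDist L M β x₁ (y j) * ‖sectorisedKernel L M β F G (m + 1) Ω (Matrix.vecCons x₁ y)‖)) := by
        rw [mul_sum]
        refine sum_congr rfl fun y _ => ?_
        rw [sum_mul, mul_sum]
        refine sum_congr rfl fun j _ => ?_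
        rw [spaceTimeDist_comm β (y j) x₁]
        ring
    _ = δ * ∑ j : Fin m, imagTimeWeight β M ^ m *
          ∑ y : Fin m → SpaceTimeIdx L M, spaceTimeDist L M β x₁ (y j) * ‖sectorisedKernel L M β F G (m + 1) Ω (Matrix.vecCons x₁ y)‖ := by
        rw [sum_comm, mul_sum]
        refine sum_congr rfl fun j _ => ?_
        rw [mul_sum, mul_sum]

/-- **The same for the vertex functions** `𝒱_{m+1} = (m+1)!·(βL²)^m·K` (`vertexFn`):
`‖(∏F·𝒱)(k) − (∏F·𝒱)(k′)‖ ≤ (m+1)!·δ·Σ_j ε^m Σ_y spaceTimeDist x₁ (y_j)·‖W_Ω(x₁ :: y)‖`. -/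
theorem norm_prod_mul_vertexFn_sub_le_moments {N m : ℕ} {β : ℝ} (hβ : 0 < β) (F : Fin N → FreqMomentum L M → ℂ) (G : HubbardGrassmann L M)
    (hfreq : ∀ (m : ℕ) (X : Fin m → HubbardFieldIdx L M),
      (∑ i, (if (X i).2 = 0 then (1 : ℤ) else -1) * matsubaraInt M (X i).1.1.1) ≠ 0 → kernel ℂ G m X = 0)
    (hmom : ∀ (m : ℕ) (X : Fin m → HubbardFieldIdx L M), (∑ i, signedMomentum L (X i).2 (X i).1.1.2) ≠ 0 → kernel ℂ G m X = 0)
    (Ω : Fin (m + 1) → SectorLeg N) (k k' : Fin (m + 1) → FreqMomentum L M)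
    (hf : ∑ i, (if (Ω i).2 = 0 then (1 : ℤ) else -1) * matsubaraInt M (k i).1 = 0) (hm : ∑ i, signedMomentum L (Ω i).2 (k i).2 = 0)
    (hf' : ∑ i, (if (Ω i).2 = 0 then (1 : ℤ) else -1) * matsubaraInt M (k' i).1 = 0) (hm' : ∑ i, signedMomentum L (Ω i).2 (k' i).2 = 0)
    (x₁ : SpaceTimeIdx L M) {δ : ℝ}
    (hδ : ∀ j : Fin m, |matsubaraFreq β M (k j.succ).1 - matsubaraFreq β M (k' j.succ).1| + 2 * klTorusNorm L ((k j.succ).2 - (k' j.succ).2) ≤ δ) :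
    ‖(∏ i, F (Ω i).1.1 (k i)) * vertexFn L M β G (m + 1) (fun i => ((k i, (Ω i).1.2), (Ω i).2)) -
        (∏ i, F (Ω i).1.1 (k' i)) * vertexFn L M β G (m + 1) (fun i => ((k' i, (Ω i).1.2), (Ω i).2))‖ ≤
      (m + 1).factorial * (δ * ∑ j : Fin m, imagTimeWeight β M ^ m *
        ∑ y : Fin m → SpaceTimeIdx L M, spaceTimeDist L M β x₁ (y j) * ‖sectorisedKernel L M β F G (m + 1) Ω (Matrix.vecCons x₁ y)‖) := by
  have h := pow_mul_norm_prodKernel_sub_le_moments hβ F G hfreq hmom Ω k k' hf hm hf' hm' x₁ hδ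
  have hfac : (0 : ℝ) ≤ (m + 1).factorial := Nat.cast_nonneg _
  have hβL : 0 ≤ (β * (L : ℝ) ^ 2) ^ m := pow_nonneg (mul_nonneg hβ.le (sq_nonneg _)) m
  rw [vertexFn_def, vertexFn_def, Nat.add_sub_cancel]
  have hre : (∏ i, F (Ω i).1.1 (k i)) * (((((m + 1).factorial : ℝ) * (β * (L : ℝ) ^ 2) ^ m : ℝ) : ℂ) * kernel ℂ G (m + 1) (fun i => ((k i, (Ω i).1.2), (Ω i).2))) -
      (∏ i, F (Ω i).1.1 (k' i)) * (((((m + 1).factorial : ℝ) * (β * (L : ℝ) ^ 2) ^ m : ℝ) : ℂ) * kernel ℂ G (m + 1) (fun i => ((k' i, (Ω i).1.2), (Ω i).2))) =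
      ((((m + 1).factorial : ℝ) * (β * (L : ℝ) ^ 2) ^ m : ℝ) : ℂ) *
        ((∏ i, F (Ω i).1.1 (k i)) * kernel ℂ G (m + 1) (fun i => ((k i, (Ω i).1.2), (Ω i).2)) -
          (∏ i, F (Ω i).1.1 (k' i)) * kernel ℂ G (m + 1) (fun i => ((k' i, (Ω i).1.2), (Ω i).2))) := by ring
  rw [hre, norm_mul, Complex.norm_real, Real.norm_eq_abs, abs_of_nonneg (mul_nonneg hfac hβL), mul_assoc]
  exact mul_le_mul_of_nonneg_left h hfac

end Pinned

/-! ## §4 Instances on `𝒱ₙ[K] = klEffectiveAction … n` -/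

section Model

/-- **The class-#6 size does not depend on the pin**: `fixedTupleL1 β 3 (klIsoKernelAt … K n m) Ω x₁ = fixedTupleL1 β 3 (klIsoKernelAt … K n m) Ω x₁'` (`β ≠ 0`). -/
theorem fixedTupleL1_klIsoKernelAt_pin_indep {β : ℝ} (hβ : β ≠ 0) (U μ : ℝ) (K : TrigPolyC4v) (n m : ℕ)
    (Ω : Fin 4 → SectorLeg (sectorCount (2 * m))) (x₁ x₁' : SpaceTimeIdx L M) :
    fixedTupleL1 L M β 3 (klIsoKernelAt L M β U μ K n m) Ω x₁ = fixedTupleL1 L M β 3 (klIsoKernelAt L M β U μ K n m) Ω x₁' :=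
  fixedTupleL1_sectorisedKernel_pin_indep hβ (klIsoFamily L M β μ K klE0 m) (klEffectiveAction L M β U μ K klE0 n)
    (fun _ _ hX => kernel_klEffectiveAction_eq_zero_of_freq β U μ K klE0 n hX)
    (fun m' X hX => klEffectiveAction_momentumConserving β U μ K klE0 n m' X hX) Ω x₁ x₁'

/-- **The (E4) first moments of `𝒱ₙ[K]`'s quartic kernel do not depend on the pin** (any multiplier family; (E4) pins leg `0` at the origin,
(E5-F)/class #6 at an arbitrary `x₁`). -/
theorem firstMoment_klEffectiveAction_pin_indep {N : ℕ} {β : ℝ} (hβ : β ≠ 0) (F : Fin N → FreqMomentum L M → ℂ) (U μ : ℝ) (K : TrigPolyC4v) (e₀ : ℝ)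
    (n : ℕ) {m : ℕ} (Ω : Fin (m + 1) → SectorLeg N) (i j : Fin (m + 1)) (x₁ x₁' : SpaceTimeIdx L M) :
    ∑ y : Fin m → SpaceTimeIdx L M, spaceTimeDist L M β (Matrix.vecCons x₁ y i) (Matrix.vecCons x₁ y j) *
        ‖sectorisedKernel L M β F (klEffectiveAction L M β U μ K e₀ n) (m + 1) Ω (Matrix.vecCons x₁ y)‖ =
      ∑ y : Fin m → SpaceTimeIdx L M, spaceTimeDist L M β (Matrix.vecCons x₁' y i) (Matrix.vecCons x₁' y j) *
        ‖sectorisedKernel L M β F (klEffectiveAction L M β U μ K e₀ n) (m + 1) Ω (Matrix.vecCons x₁' y)‖ :=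
  firstMoment_sectorisedKernel_pin_indep hβ F (klEffectiveAction L M β U μ K e₀ n)
    (fun _ _ hX => kernel_klEffectiveAction_eq_zero_of_freq β U μ K e₀ n hX)
    (fun m' X hX => klEffectiveAction_momentumConserving β U μ K e₀ n m' X hX) Ω i j x₁ x₁'

/-- The (E4) object by name: the first moments of `klAnisoLegKernel … n 4` pinned at `0` equal those pinned at any `x₁`. -/
theorem firstMoment_klAnisoLegKernel_pin_indep {β : ℝ} (hβ : β ≠ 0) (U μ : ℝ) (K : TrigPolyC4v) (n : ℕ)
    (Ω : Fin 4 → SectorLeg (sectorCount n)) (i j : Fin 4) (x₁ : SpaceTimeIdx L M) :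
    ∑ y : Fin 3 → SpaceTimeIdx L M, spaceTimeDist L M β (Matrix.vecCons (0 : SpaceTimeIdx L M) y i) (Matrix.vecCons (0 : SpaceTimeIdx L M) y j) *
        ‖klAnisoLegKernel L M β U μ K klE0 n 4 Ω (Matrix.vecCons (0 : SpaceTimeIdx L M) y)‖ =
      ∑ y : Fin 3 → SpaceTimeIdx L M, spaceTimeDist L M β (Matrix.vecCons x₁ y i) (Matrix.vecCons x₁ y j) *
        ‖klAnisoLegKernel L M β U μ K klE0 n 4 Ω (Matrix.vecCons x₁ y)‖ :=
  firstMoment_klEffectiveAction_pin_indep hβ (klAnisoFamily L M β μ K klE0 n) U μ K klE0 n Ω i j 0 x₁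

/-- **MOMENT-LIPSCHITZ OF `𝒱ₙ[K]`'S MOMENTUM KERNELS** under any multiplier family (`0 < β`; `k`, `k′` on the conservation surface; any pin `x₁`; `δ` a common bound
of the free legs' dual distances): `(βL²)^m·‖(∏F·K)(k) − (∏F·K)(k′)‖ ≤ δ·Σ_j ε^m Σ_y spaceTimeDist x₁ (y_j)·‖W_Ω(x₁ :: y)‖`. -/
theorem pow_mul_norm_prodKernel_klEffectiveAction_sub_le_moments {N m : ℕ} {β : ℝ} (hβ : 0 < β) (F : Fin N → FreqMomentum L M → ℂ)
    (U μ : ℝ) (K : TrigPolyC4v) (e₀ : ℝ) (n : ℕ) (Ω : Fin (m + 1) → SectorLeg N) (k k' : Fin (m + 1) → FreqMomentum L M)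
    (hf : ∑ i, (if (Ω i).2 = 0 then (1 : ℤ) else -1) * matsubaraInt M (k i).1 = 0) (hm : ∑ i, signedMomentum L (Ω i).2 (k i).2 = 0)
    (hf' : ∑ i, (if (Ω i).2 = 0 then (1 : ℤ) else -1) * matsubaraInt M (k' i).1 = 0) (hm' : ∑ i, signedMomentum L (Ω i).2 (k' i).2 = 0)
    (x₁ : SpaceTimeIdx L M) {δ : ℝ}
    (hδ : ∀ j : Fin m, |matsubaraFreq β M (k j.succ).1 - matsubaraFreq β M (k' j.succ).1| + 2 * klTorusNorm L ((k j.succ).2 - (k' j.succ).2) ≤ δ) :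
    (β * (L : ℝ) ^ 2) ^ m *
        ‖(∏ i, F (Ω i).1.1 (k i)) * kernel ℂ (klEffectiveAction L M β U μ K e₀ n) (m + 1) (fun i => ((k i, (Ω i).1.2), (Ω i).2)) -
          (∏ i, F (Ω i).1.1 (k' i)) * kernel ℂ (klEffectiveAction L M β U μ K e₀ n) (m + 1) (fun i => ((k' i, (Ω i).1.2), (Ω i).2))‖ ≤
      δ * ∑ j : Fin m, imagTimeWeight β M ^ m * ∑ y : Fin m → SpaceTimeIdx L M,
        spaceTimeDist L M β x₁ (y j) * ‖sectorisedKernel L M β F (klEffectiveAction L M β U μ K e₀ n) (m + 1) Ω (Matrix.vecCons x₁ y)‖ :=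
  pow_mul_norm_prodKernel_sub_le_moments hβ F (klEffectiveAction L M β U μ K e₀ n)
    (fun _ _ hX => kernel_klEffectiveAction_eq_zero_of_freq β U μ K e₀ n hX)
    (fun m' X hX => klEffectiveAction_momentumConserving β U μ K e₀ n m' X hX) Ω k k' hf hm hf' hm' x₁ hδ

/-- **The vertex-function form for `𝒱ₙ[K]`**: `‖(∏F·𝒱_{m+1})(k) − (∏F·𝒱_{m+1})(k′)‖ ≤ (m+1)!·δ·Σ_j ε^m Σ_y spaceTimeDist x₁ (y_j)·‖W_Ω(x₁ :: y)‖`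
(`vertexFn L M β (klEffectiveAction … n)`; the (E5-F) hypothesis is a bound on `vertexFn` at `m + 1 = 4`, `klQuarticValue`). -/
theorem norm_prod_mul_vertexFn_klEffectiveAction_sub_le_moments {N m : ℕ} {β : ℝ} (hβ : 0 < β) (F : Fin N → FreqMomentum L M → ℂ)
    (U μ : ℝ) (K : TrigPolyC4v) (e₀ : ℝ) (n : ℕ) (Ω : Fin (m + 1) → SectorLeg N) (k k' : Fin (m + 1) → FreqMomentum L M)
    (hf : ∑ i, (if (Ω i).2 = 0 then (1 : ℤ) else -1) * matsubaraInt M (k i).1 = 0) (hm : ∑ i, signedMomentum L (Ω i).2 (k i).2 = 0)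
    (hf' : ∑ i, (if (Ω i).2 = 0 then (1 : ℤ) else -1) * matsubaraInt M (k' i).1 = 0) (hm' : ∑ i, signedMomentum L (Ω i).2 (k' i).2 = 0)
    (x₁ : SpaceTimeIdx L M) {δ : ℝ}
    (hδ : ∀ j : Fin m, |matsubaraFreq β M (k j.succ).1 - matsubaraFreq β M (k' j.succ).1| + 2 * klTorusNorm L ((k j.succ).2 - (k' j.succ).2) ≤ δ) :
    ‖(∏ i, F (Ω i).1.1 (k i)) * vertexFn L M β (klEffectiveAction L M β U μ K e₀ n) (m + 1) (fun i => ((k i, (Ω i).1.2), (Ω i).2)) -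
        (∏ i, F (Ω i).1.1 (k' i)) * vertexFn L M β (klEffectiveAction L M β U μ K e₀ n) (m + 1) (fun i => ((k' i, (Ω i).1.2), (Ω i).2))‖ ≤
      (m + 1).factorial * (δ * ∑ j : Fin m, imagTimeWeight β M ^ m * ∑ y : Fin m → SpaceTimeIdx L M,
        spaceTimeDist L M β x₁ (y j) * ‖sectorisedKernel L M β F (klEffectiveAction L M β U μ K e₀ n) (m + 1) Ω (Matrix.vecCons x₁ y)‖) :=
  norm_prod_mul_vertexFn_sub_le_moments hβ F (klEffectiveAction L M β U μ K e₀ n)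
    (fun _ _ hX => kernel_klEffectiveAction_eq_zero_of_freq β U μ K e₀ n hX)
    (fun m' X hX => klEffectiveAction_momentumConserving β U μ K e₀ n m' X hX) Ω k k' hf hm hf' hm' x₁ hδ

end Model

end Summit.HubbardSuperconductivity.HubbardSuperconductivity.Theorems.EngineV8

end
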